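import Mathlib
import HarnessLib
import Literature.NumberTheory.LFunctions.SuzukiCanonicalSystem
import Summits.RiemannHypothesis.RiemannHypothesis.Theorems.SuzukiWindowsDoorPlumbing
import Summits.RiemannHypothesis.RiemannHypothesis.Theorems.SuzukiWindowsDoorOpPath
import Summits.RiemannHypothesis.RiemannHypothesis.Theses.SuzukiWindowsDoor

/-!
# RiemannHypothesis / SuzukiWindowsDoor — crux A1 `WindowsImplyContraction` (stmt-RiemannHypothesis-19732) PROVED (RH-FREE, ζ-FREE)

Closes the rank-2 crux of route `route-RiemannHypothesis-SuzukiWindowsDoor` BY NAME: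
`suzukiWindowsDoor_windowsImplyContraction_proof : …Theses.SuzukiWindowsDoor.WindowsImplyContraction` — for a
continuous real kernel `K` whose truncated Hankel operators have no unit eigenvalue in ANY window
(`Literature.NumberTheory.LFunctions.NoUnitEigenvalue K t` for all `t ≥ 0`), every window output is square-integrable
on the line with `∫_ℝ (𝖪[t]f)² ≤ ∫_{(−t,t)} f²`. The kernel-checked composition `WindowsImplyContraction_of` of LINE
«plumbing» (planner rh-dbr-theory g5) with all four registered stubs and the core landed:
`…Cruxes.WindowsImplyContraction.Plumbing.{stub_opPath (file SuzukiWindowsDoorOpPath), pathContraction,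
stub_eigenTransfer, stub_windowIneq, stub_lineOfWindows (file SuzukiWindowsDoorPlumbing)}`.
RH-FREE mathematics about an RH-equivalent criterion ([Su20] arXiv:1907.07302, Thm 1.2/1.5); nothing here bears on
the truth of RH.
-/

-- D-0017: `Summit.<S>.<S>.…` is the designed namespace of a single-problem summit.
set_option linter.dupNamespace false

namespace Summit.RiemannHypothesis.RiemannHypothesis.Theorems

open Summit.RiemannHypothesis.RiemannHypothesis.Cruxes.WindowsImplyContraction.Plumbing in
/-- **Route `SuzukiWindowsDoor`, crux A1 `WindowsImplyContraction` (stmt-RiemannHypothesis-19732) — PROVED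
(RH-FREE, ζ-FREE).** No unit eigenvalue of `𝖪[t]` in any window ⟹ every window map is a contraction into `L²(ℝ)`. -/
theorem suzukiWindowsDoor_windowsImplyContraction_proof :
    Summit.RiemannHypothesis.RiemannHypothesis.Theses.SuzukiWindowsDoor.WindowsImplyContraction := by
  intro K hK hW
  refine stub_lineOfWindows K hK fun t ht f hf => ?_
  obtain ⟨T, hc, h0, hsk, hR⟩ := stub_opPath K hK
  have hn : ∀ t : ℝ, 0 ≤ t → ‖T t‖ < 1 :=
    pathContraction T hc h0 (fun s hs => (hsk s hs).1) (fun s hs => (hsk s hs).2)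
      (fun s hs => stub_eigenTransfer K hK T hR s hs (hW s hs))
  exact stub_windowIneq K hK T hR t ht (hn t ht) f hf

end Summit.RiemannHypothesis.RiemannHypothesis.Theorems
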